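import Summits.Ventures.QEC.Census.BB.A1s_n168_k18_7144a1e2.CoverWitZ1
import Summits.Ventures.QEC.Census.BB.A1s_n168_k18_7144a1e2.CoverWitZ9
import Summits.Ventures.QEC.Census.BB.A1s_n168_k18_7144a1e2.CoverWitZ10
import Summits.Ventures.QEC.Census.BB.A1s_n168_k18_7144a1e2.CoverWitZ11
import Summits.Ventures.QEC.Census.BB.A1s_n168_k18_7144a1e2.Cert
import HarnessLib

/-!
# Census row `A1s_n168_k18_7144a1e2` (`[[168,18,8]]`): the LABEL COVER by translations, witnessed and chunked, tier KERNEL — part 4/4 (chunks 8…10)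
# (qec-search-10 g4: the one-file form p520581 exceeded the gate's 600 s elaboration budget with 11 chunks ⇒ ≤ 3 chunks per file; glued in `CoverZ.lean`)

-/

set_option Elab.async false

namespace Summit.Ventures.QEC.Census.A1s_n168_k18_7144a1e2

open Summit.Ventures.QEC.Census

set_option maxHeartbeats 4000000 in
/-- Labels `[196609, 221185)` are covered (each by its witnessed block / translation; KERNEL, 24576 one-line checks, split depth 6). -/
theorem covZ_8 : coverAutTabWitOK A1s_n168_k18_7144a1e2.coverTabZ 21 59 6 196609 24576 A1s_n168_k18_7144a1e2.witsZ_8 = true := by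
  decide +kernel

set_option maxHeartbeats 4000000 in
/-- Labels `[221185, 245761)` are covered (each by its witnessed block / translation; KERNEL, 24576 one-line checks, split depth 6). -/
theorem covZ_9 : coverAutTabWitOK A1s_n168_k18_7144a1e2.coverTabZ 21 59 6 221185 24576 A1s_n168_k18_7144a1e2.witsZ_9 = true := by
  decide +kernel

set_option maxHeartbeats 4000000 in
/-- Labels `[245761, 262144)` are covered (each by its witnessed block / translation; KERNEL, 16383 one-line checks, split depth 5). -/
theorem covZ_10 : coverAutTabWitOK A1s_n168_k18_7144a1e2.coverTabZ 21 59 5 245761 16383 A1s_n168_k18_7144a1e2.witsZ_10 = true := by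
  decide +kernel

end Summit.Ventures.QEC.Census.A1s_n168_k18_7144a1e2
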